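import Literature.RingTheory.FormalGroups.FormalGroupStrictIsoTransport
import HarnessLib

/-!
# Crux `HLiu418` — P6 sub-line **F0-P6d LubinTateFormalModuli**, stub (c0) `StubC0LiftTypified` PAID

Cell `hodgecm-mathlib`, P6 «MOD programme» Row 4B, line `Cruxes/HLiu418/Lines/F0_P6d_LubinTateFormalModuli.lean`
(F0P6d-plan (g0), tree sha16 `b61911ed76ed3d88`), registered stub (c0) `stub_L4B3c0 : StubC0LiftTypified` («lift a typified
law», :137–:144 of the line). This file proves THE TEXT OF `StubC0LiftTypified` VERBATIM (same binders, same universe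
order `{u, v}`) as the theorem `stubC0LiftTypified`, so that the desk folds `stub_L4B3c0 := F0P6dStubC0LiftTypified.stubC0LiftTypified`
BY NAME at the next edition. The proof is the ★ Literature organ
`Literature.RingTheory.FormalGroups.exists_formalGroup_map_eq_of_strictIso_map` (`FormalGroupStrictIsoTransport.lean`:
transport of structure of a Mathlib `FormalGroup` along a lifted strict isomorphism). HC_CM is proved only modulo the
printed citations until rung 0 closes; nothing here is about HC — it discharges one registered stub of the P6d line.
-/

-- The cell's namespace `Summit.HodgeConjecture.HodgeConjecture.…` repeats `HodgeConjecture` (summit = sub-problem), which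
-- `linter.dupNamespace` flags; the lakefile turns the linter off tree-wide (weak option), restated here so stand-alone elaboration is
-- warning-free.
set_option linter.dupNamespace false

namespace Summit.HodgeConjecture.HodgeConjecture.Cruxes.HLiu418.F0P6dStubC0LiftTypified

universe u v

open Literature.RingTheory.FormalGroups (FormalGroupHom)

/-- **Stub (c0) «lift a typified law» — the text of `F0P6dLubinTateFormalModuli.StubC0LiftTypified` verbatim.** Let
`π : A′ ↠ A` be surjective, `f′ : R₀ → A′`, `f = π ∘ f′`, `H₀` a commutative law over `R₀`, and `G` a commutative law over
`A` with a strict isomorphism `ψ : G → H₀.map f` (`ψ ≡ T (mod deg 2)`); then `G` lifts to a commutative law `G′` over `A′`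
with `G′.map π = G`. Proof: ★ `exists_formalGroup_map_eq_of_strictIso_map` (lift `ψ` to a strict `ψ′`, invert, transport
`H₀.map f′` along `ψ′`). [cite: Hazewinkel1978, §1.2–§1.3] [cite: LubinTate1966, §1] -/
theorem stubC0LiftTypified :
    ∀ (R₀ : Type v) (A' A : Type u) [CommRing R₀] [CommRing A'] [CommRing A] (π : A' →+* A), Function.Surjective π →
    ∀ (f' : R₀ →+* A') (f : R₀ →+* A), π.comp f' = f → ∀ (H₀ : FormalGroup R₀), H₀.IsComm →
    ∀ (G : FormalGroup A), G.IsComm →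
    ∀ (ψ : FormalGroupHom G (H₀.map f)), PowerSeries.coeff 1 ψ.toPowerSeries = 1 →
      ∃ G' : FormalGroup A', G'.IsComm ∧ G'.map π = G :=
  fun R₀ A' A _ _ _ π hπ f' f hf H₀ hH₀ G hG ψ hψ1 =>
    Literature.RingTheory.FormalGroups.exists_formalGroup_map_eq_of_strictIso_map R₀ A' A π hπ f' f hf H₀ hH₀ G hG ψ hψ1

end Summit.HodgeConjecture.HodgeConjecture.Cruxes.HLiu418.F0P6dStubC0LiftTypified
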